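import Literature.Probability.LatticeModels.TruncatedWeightLipschitz
import Summits.QuantumFields.BalabanUV.T4Continuum.Spine.NE7.Targets

/-!
# YM-DAG node N19 (= NE7 proper) — `Spine.NE7.Target` READ OFF A SOURCE-LOCAL KOTECKÝ–PREISS GAS REPRESENTATION of the dressed partition
# functions: each run's generating-function increment lives on the clusters MEETING the source support, the two-run difference is matched
# modulo the CANONICAL constant `log Z_B(0) − log Z_A(0)`, and the remainder is the two-run activity discrepancy DISCOUNTED by the
# decay-distance to the support — the one-class road to node U5's target, which never asks a class-uniform constant

Cell `pub-ymgap`, HUMAN RULING D-0062 (Track A), width seat `pub-ymgap-dag-n19-w2` (node n19 = NE7), generation g7 (explicit-unit brief «take a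
sub-lemma no sibling holds», R455 (A) rule (ii) self-located piece; CLAIM-1 on the cell bus 2026-08-28T10:15Z, FILE B of two; FILE A =
`…N19CoreOfClassGasReading`, the `Core` face with its class-uniform constant).  Route `Summits/QuantumFields/YangMills/Theses/BalabanUVNodes.lean`,
key item K3⁸ `SpineGivenEndpointR13SepCoPHV` (stmt-QuantumFields-27366; aside predecessor K3⁷ 20544); filed `--kind proof --supports … --as helper`.
COUNT-NEUTRAL.  THEOREMS ONLY (0 `def`, 0 `instance`, 0 `sorry`).  Imports the tree's KERNEL-PROVED Kotecký–Preiss library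
(`Literature.Probability.LatticeModels.{ClusterExpansion, PolymerLogZLipschitz, TruncatedWeightLipschitz}`) and `Spine/NE7/Targets`
(`Target vol l₀ δ Z := T4CauchySum.MatchingModConstants vol l₀ δ Z ∧ Summable δ`); every cluster-expansion fact is used BY NAME.

THE POINT.  Node U5's DECL target `MatchingModConstants vol l₀ δ Z` asks, per `K`, ONE `t`-independent constant `c_K` with
`|log Z_{K+1}(t) − log Z_K(t) − c_K| ≤ vol·δ_K` on `|t| ≤ l₀`; the CANONICAL choice is `c_K = log Z_{K+1}(0) − log Z_K(0)` (n19-e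
`N19CoreMetric.matchingModConstants_of_genFun_increments`), which turns the clause into a bound on the two-run difference of the
GENERATING-FUNCTION INCREMENTS `[log Z_{K+1}(t) − log Z_{K+1}(0)] − [log Z_K(t) − log Z_K(0)]`.  When the two dressed partition functions are
READ as Kotecký–Preiss polymer gases whose activities depend on the source `t` ONLY on the polymers of a set `S` (those meeting the
observable's support — the source term multiplies a loop functional supported there), each increment is a sum over the clusters MEETING
`S` (§1, Möbius inversion — no smallness), the whole bulk of the two-run discrepancy (vacuum-energy-type terms far from the loop, however
large) sits in the canonical constant, and the tree's ANCHORED two-family Lipschitz bound with a LOCAL right-hand side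
(`TruncatedWeightLipschitz.sum_filter_norm_truncatedWeight_sub_mul_exp_le_local`) bounds what is left by the two-run activity discrepancy
DISCOUNTED by the decay-distance to `S` (§2) — LOCAL at the loop, not extensive in the torus.  This is the abstract form of the small-field
half of [King1986] (3.10)–(3.13) pp. 656–657 (d = 2, 3; context only) and of what `T4CauchySum`'s header calls «only t-DEPENDENT parts of
log Z survive; every field-independent constant quotients out»; §3 packages it along `K` into `MatchingModConstants` and `Target`.

WHAT IS KERNEL-CHECKED ([folklore] algebra over the tree's theorems BY NAME).
* §1 `polymerLogZ_sub_eq_sum_filter_meet` (NO smallness): two families agreeing on `L` off `S` have `log Z(L; w) − log Z(L; w′) =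
  Σ_{C ⊆ L, C ∩ S ≠ ∅}(Φ^T(C; w) − Φ^T(C; w′))` (`polymerLogZ_eq_sum_truncatedWeight` + `truncatedWeight_congr`); `incr_sub_incr_eq_sum_filter_meet`:
  the two-run difference of increments = a sum over the clusters meeting `S` of double differences.
* §2 `norm_incr_sub_incr_le_local`: `a, d, e ≥ 0`, a common dominating profile `ω` of the four families `w_A^t, w_A^0, w_B^t, w_B^0` on `L`
  obeying hypothesis (1) with weight `d + e`, source locality off `S` per run, a DISCOUNT `m` with `m δ ≤ Σ_{γ∈C} e γ` on every cluster `C ⊆ L`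
  through `δ` meeting `S` ⇒ `‖(log Z_B^t − log Z_A^t) − (log Z_B^0 − log Z_A^0)‖ ≤ Σ_{δ∈L} e^{−m δ}(‖w_A^t δ − w_B^t δ‖ + ‖w_A^0 δ − w_B^0 δ‖)e^{a δ+d δ+e δ}`;
  `isKPVolume_of_dominated`; `abs_log_re_incr_sub_incr_le_local`: the real-logarithm form for REAL activities (`polymerLogZ_eq_log_of_real`).
* §3 ALONG `K`.  `matchingModConstants_of_sourceLocalReading`: ONE sequence `Z : ℕ → ℝ → ℝ` READ on `|t| ≤ l₀` as `Z K t = κ_A K · Z(L K; w_A^{K,t}).re`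
  (run A of pair `K`) and `Z (K+1) t = κ_B K · Z(L K; w_B^{K,t}).re` (run B) — the dictionary E1∕E2 of `T4MatchingAssembly`, `t`-independent positive
  normalisations `κ` (explicit counterterms) — with the discounted budget `≤ vol·δ_K` ⇒ `MatchingModConstants vol l₀ δ Z`, constants
  `c_K = (log κ_B K − log κ_A K) + (log Z_B^{K,0} − log Z_A^{K,0})`; `target_of_sourceLocalReading`: + `Summable δ` ⇒ `NE7.Target vol l₀ δ Z`.
* §4 SANITY (A6): the EMPTY polymer volume inhabits every hypothesis of §3 (`target_of_sourceLocalReading_empty`: `Z ≡ 1`, `δ ≡ 0`) —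
  content-free, joint satisfiability only.
LOCATED REMARKS.  (i) FILE A's undiscounted budget with the hybrid split is the companion for ONE class; across classes `Core` needs a
class-uniform constant, which the canonical constants of this file are NOT (they are per gas pair) — this road serves the node's `Target` for
a ONE-TERM reading (dag-n20-w1 `…N20OffLiveOneTermReading`: `core_oneTerm_iff_matchingModConstants`) or per class the
`t`-INCREMENT matching that the N14 face consumes, not the hybrid `Core` across law-separated classes (window-key-core ed.2 «no dial rescues»).
(ii) Instantiation for Bałaban's runs needs the (1.98)∕(2.13) representation of BOTH runs' dressed densities on a COMMON polymer geometry,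
hypothesis (1) for both with a decay weight `e` (printed for ONE run: [Balaban1989LargeFieldII] (1.97)∕(1.99); [Balaban1988RG2Cluster] Lemma 3
(2.38)), SOURCE LOCALITY of the activities (the observable enters Bałaban's densities through the characteristic-function source of
[Balaban1989LargeFieldII] p. 356 — its locality at the activity level is NOT PRINTED), and the discounted two-run rate `≤ vol·δ_K`, `Σδ_K < ∞`
(NE-R1 two-run half ∕ NE5-ACT ∕ NE7b-rem — NOT PRINTED) — BINDERS, produced by nobody.

HONEST FRAMING.  [folklore]-grade bookkeeping over the tree's kernel-proved abstract cluster expansion ([KoteckyPreiss1986] Theorem p. 492, as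
formalised in `Literature.Probability.LatticeModels` — a PUBLISHED result outside the audited series) on HYPOTHESIS SHAPES; ZERO Bałaban content
instantiated; NE7 ∕ NE7b ∕ NE7c NOT PRINTED as two-run statements for d = 4 and NOT proved; N19 ∕ N20 ∕ N21 NOT discharged; K3⁸ 27366 OPEN
(«v6» pending registration), K3⁷ 20544 aside, neither claimed; counts UNMOVED (typed 28∕28 · discharged 5∕27, A 5∕28); no count claim.  One
finite four-torus programme at fixed ε, Bałaban AS PRINTED; R4 closes the conditional finite-𝕋⁴ rung `BalabanLadder.UV` only — NOT infinite
volume, NOT OS on ℝ⁴, NOT the Yang–Mills mass gap, NOT the Clay problem.  0 `def`; 0 `sorry`; standard axioms; no cite tags (Summits side).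
-/

noncomputable section

open Finset
open scoped BigOperators

namespace Summit.QuantumFields.YangMills.BalabanUVNodes.N19TargetOfSourceLocalGasReading

open Literature.Probability.LatticeModels
open Literature.MathematicalPhysics.QuantumFieldTheory.Balaban1983to89.T4CauchySum (MatchingModConstants)
open Summit.QuantumFields.BalabanUV.T4Continuum.Spine

variable {P : Type*} [DecidableEq P] {inc : P → P → Prop} [DecidableRel inc]

/-! ## §1–§2 ONE GAS PAIR: source locality — the increments live on the clusters meeting the source support; the discounted two-run bound -/

section SourceLocal

/-- **SOURCE LOCALITY OF THE INCREMENT** (no smallness needed).  If two activity families `w`, `w'` agree on `L` off a set `S`, then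
`log Z(L; w) − log Z(L; w') = Σ_{C ⊆ L, C ∩ S ≠ ∅} (Φ^T(C; w) − Φ^T(C; w'))`: Möbius inversion (2) for both (`polymerLogZ_eq_sum_truncatedWeight`)
and `Φ^T(C; w) = Φ^T(C; w')` on the families missing `S` (`truncatedWeight_congr`).  For `w = w^t`, `w' = w^0` (a run's activities at
source `t` and at source `0`, `S` = the polymers meeting the observable's support) this is the generating-function increment of the run as
a sum over the clusters meeting the support. [folklore] -/
theorem polymerLogZ_sub_eq_sum_filter_meet {w w' : P → ℂ} {L S : Finset P} (h : ∀ γ ∈ L, γ ∉ S → w γ = w' γ) :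
    polymerLogZ inc w L - polymerLogZ inc w' L =
      ∑ C ∈ L.powerset with (C ∩ S).Nonempty, (truncatedWeight inc w C - truncatedWeight inc w' C) := by
  rw [polymerLogZ_eq_sum_truncatedWeight, polymerLogZ_eq_sum_truncatedWeight, ← Finset.sum_sub_distrib,
    ← Finset.sum_filter_add_sum_filter_not L.powerset (fun C => (C ∩ S).Nonempty)]
  have hzero : ∑ C ∈ L.powerset with ¬ (C ∩ S).Nonempty, (truncatedWeight inc w C - truncatedWeight inc w' C) = 0 := by
    refine Finset.sum_eq_zero fun C hC => ?_
    obtain ⟨hCL, hCS⟩ := Finset.mem_filter.1 hC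
    rw [Finset.not_nonempty_iff_eq_empty] at hCS
    rw [sub_eq_zero]
    refine truncatedWeight_congr fun γ hγ => h γ (Finset.mem_powerset.1 hCL hγ) fun hγS => ?_
    have : γ ∈ C ∩ S := Finset.mem_inter.2 ⟨hγ, hγS⟩
    rw [hCS] at this
    exact Finset.notMem_empty γ this
  rw [hzero, add_zero]

/-- **THE TWO-RUN DIFFERENCE OF INCREMENTS IS A SUM OVER THE CLUSTERS MEETING THE SOURCE SUPPORT.**  With run A's families `wA` (source `t`),
`wA₀` (source `0`) agreeing off `S`, and run B's `wB`, `wB₀` likewise: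
`(log Z_B^t − log Z_A^t) − (log Z_B^0 − log Z_A^0) = Σ_{C ⊆ L, C ∩ S ≠ ∅} ((Φ^T(C;wB) − Φ^T(C;wA)) − (Φ^T(C;wB₀) − Φ^T(C;wA₀)))` — the constant
`log Z_B^0 − log Z_A^0` has absorbed every cluster missing `S`. [folklore] -/
theorem incr_sub_incr_eq_sum_filter_meet {wA wA₀ wB wB₀ : P → ℂ} {L S : Finset P}
    (hSA : ∀ γ ∈ L, γ ∉ S → wA γ = wA₀ γ) (hSB : ∀ γ ∈ L, γ ∉ S → wB γ = wB₀ γ) :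
    (polymerLogZ inc wB L - polymerLogZ inc wA L) - (polymerLogZ inc wB₀ L - polymerLogZ inc wA₀ L) =
      ∑ C ∈ L.powerset with (C ∩ S).Nonempty,
        ((truncatedWeight inc wB C - truncatedWeight inc wA C) - (truncatedWeight inc wB₀ C - truncatedWeight inc wA₀ C)) := by
  have hB := polymerLogZ_sub_eq_sum_filter_meet (inc := inc) hSB
  have hA := polymerLogZ_sub_eq_sum_filter_meet (inc := inc) hSA
  have hre : (polymerLogZ inc wB L - polymerLogZ inc wA L) - (polymerLogZ inc wB₀ L - polymerLogZ inc wA₀ L) =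
      (polymerLogZ inc wB L - polymerLogZ inc wB₀ L) - (polymerLogZ inc wA L - polymerLogZ inc wA₀ L) := by ring
  rw [hre, hB, hA, ← Finset.sum_sub_distrib]
  exact Finset.sum_congr rfl fun C _ => by ring

variable [Std.Refl inc] [Std.Symm inc]

/-- **THE DISCOUNTED TWO-RUN BOUND ON THE INCREMENTS** (= on `log Z_B^t − log Z_A^t` minus the CANONICAL constant `log Z_B^0 − log Z_A^0`).
Hypotheses: `a, d, e ≥ 0`; a common dominating profile `ω` of all four families on `L` obeying the Kotecký–Preiss hypothesis (1) with
weight `d + e`; source locality off `S` for each run; a DISCOUNT `m` with `m δ ≤ Σ_{γ∈C} e γ` for every cluster `C ⊆ L` through `δ`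
meeting `S` (e.g. `e` a size, `m δ` the tree-distance from `δ` to `S`).  Then
`‖(log Z_B^t − log Z_A^t) − (log Z_B^0 − log Z_A^0)‖ ≤ Σ_{δ∈L} e^{−m δ}·(‖wA δ − wB δ‖ + ‖wA₀ δ − wB₀ δ‖)·e^{a δ + d δ + e δ}`:
the two-run activity discrepancy DISCOUNTED by the decay-distance to the source support.  The cluster work is the tree's
`TruncatedWeightLipschitz.sum_filter_norm_truncatedWeight_sub_mul_exp_le_local` BY NAME (anchor = «meets `S`»), twice. [folklore] -/
theorem norm_incr_sub_incr_le_local {wA wA₀ wB wB₀ : P → ℂ} {ω a d e m : P → ℝ} {L S : Finset P}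
    (ha : ∀ γ, 0 ≤ a γ) (hd : ∀ γ, 0 ≤ d γ) (he : ∀ γ, 0 ≤ e γ)
    (hωA : ∀ δ ∈ L, ‖wA δ‖ ≤ ω δ) (hωA₀ : ∀ δ ∈ L, ‖wA₀ δ‖ ≤ ω δ) (hωB : ∀ δ ∈ L, ‖wB δ‖ ≤ ω δ) (hωB₀ : ∀ δ ∈ L, ‖wB₀ δ‖ ≤ ω δ)
    (hdom : ∀ γ ∈ L, ∑ γ' ∈ L with inc γ' γ, ω γ' * Real.exp (a γ' + (d γ' + e γ')) ≤ a γ)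
    (hSA : ∀ γ ∈ L, γ ∉ S → wA γ = wA₀ γ) (hSB : ∀ γ ∈ L, γ ∉ S → wB γ = wB₀ γ)
    (hm : ∀ C ⊆ L, (C ∩ S).Nonempty → IsPolymerCluster inc C → ∀ δ ∈ C, m δ ≤ ∑ γ ∈ C, e γ) :
    ‖(polymerLogZ inc wB L - polymerLogZ inc wA L) - (polymerLogZ inc wB₀ L - polymerLogZ inc wA₀ L)‖ ≤
      ∑ δ ∈ L, Real.exp (-m δ) * ((‖wA δ - wB δ‖ + ‖wA₀ δ - wB₀ δ‖) * Real.exp (a δ + (d δ + e δ))) := by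
  rw [incr_sub_incr_eq_sum_filter_meet hSA hSB]
  -- the weighted local bounds for the two pairs
  have hloc := sum_filter_norm_truncatedWeight_sub_mul_exp_le_local ha hd he hωA hωB hdom (fun C => (C ∩ S).Nonempty) hm
  have hloc₀ := sum_filter_norm_truncatedWeight_sub_mul_exp_le_local ha hd he hωA₀ hωB₀ hdom (fun C => (C ∩ S).Nonempty) hm
  -- drop the weights `e^{d(C)} ≥ 1`
  have hdrop : ∀ (u u' : P → ℂ),
      ∑ C ∈ L.powerset with (C ∩ S).Nonempty, ‖truncatedWeight inc u C - truncatedWeight inc u' C‖ ≤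
        ∑ C ∈ L.powerset with (C ∩ S).Nonempty, ‖truncatedWeight inc u C - truncatedWeight inc u' C‖ *
          Real.exp (∑ γ ∈ C, d γ) := by
    intro u u'
    refine Finset.sum_le_sum fun C _ => ?_
    have h1 : (1 : ℝ) ≤ Real.exp (∑ γ ∈ C, d γ) := Real.one_le_exp (Finset.sum_nonneg fun γ _ => hd γ)
    simpa using mul_le_mul_of_nonneg_left h1 (norm_nonneg (truncatedWeight inc u C - truncatedWeight inc u' C))
  calc ‖∑ C ∈ L.powerset with (C ∩ S).Nonempty,
          ((truncatedWeight inc wB C - truncatedWeight inc wA C) - (truncatedWeight inc wB₀ C - truncatedWeight inc wA₀ C))‖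
      ≤ ∑ C ∈ L.powerset with (C ∩ S).Nonempty,
          ‖(truncatedWeight inc wB C - truncatedWeight inc wA C) - (truncatedWeight inc wB₀ C - truncatedWeight inc wA₀ C)‖ :=
        norm_sum_le _ _
    _ ≤ ∑ C ∈ L.powerset with (C ∩ S).Nonempty,
          (‖truncatedWeight inc wA C - truncatedWeight inc wB C‖ + ‖truncatedWeight inc wA₀ C - truncatedWeight inc wB₀ C‖) := by
        refine Finset.sum_le_sum fun C _ => ?_
        rw [norm_sub_rev (truncatedWeight inc wA C), norm_sub_rev (truncatedWeight inc wA₀ C)]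
        exact norm_sub_le _ _
    _ = (∑ C ∈ L.powerset with (C ∩ S).Nonempty, ‖truncatedWeight inc wA C - truncatedWeight inc wB C‖) +
          ∑ C ∈ L.powerset with (C ∩ S).Nonempty, ‖truncatedWeight inc wA₀ C - truncatedWeight inc wB₀ C‖ :=
        Finset.sum_add_distrib
    _ ≤ (∑ δ ∈ L, Real.exp (-m δ) * (‖wA δ - wB δ‖ * Real.exp (a δ + (d δ + e δ)))) +
          ∑ δ ∈ L, Real.exp (-m δ) * (‖wA₀ δ - wB₀ δ‖ * Real.exp (a δ + (d δ + e δ))) :=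
        add_le_add ((hdrop wA wB).trans hloc) ((hdrop wA₀ wB₀).trans hloc₀)
    _ = ∑ δ ∈ L, Real.exp (-m δ) * ((‖wA δ - wB δ‖ + ‖wA₀ δ - wB₀ δ‖) * Real.exp (a δ + (d δ + e δ))) := by
        rw [← Finset.sum_add_distrib]
        exact Finset.sum_congr rfl fun δ _ => by ring

omit [DecidableEq P] [Std.Refl inc] [Std.Symm inc] in
/-- Hypothesis (1) with weight `d + e` for a dominated family gives the tree's `IsKPVolume` (weight dropped). [folklore] -/
theorem isKPVolume_of_dominated {w : P → ℂ} {ω a d e : P → ℝ} {L : Finset P} (hd : ∀ γ, 0 ≤ d γ) (he : ∀ γ, 0 ≤ e γ)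
    (hω : ∀ δ ∈ L, ‖w δ‖ ≤ ω δ) (hdom : ∀ γ ∈ L, ∑ γ' ∈ L with inc γ' γ, ω γ' * Real.exp (a γ' + (d γ' + e γ')) ≤ a γ) :
    IsKPVolume inc w a L :=
  isKPVolume_of_kpd (d := fun γ => d γ + e γ) (fun γ => add_nonneg (hd γ) (he γ)) (kpd_of_norm_le hω hdom)

/-- **REAL-LOGARITHM FORM** of `norm_incr_sub_incr_le_local`: for REAL activities the four partition functions are positive reals, the KP
logarithms are their real logarithms (`polymerLogZ_eq_log_of_real`), and
`|(log Z_B^t − log Z_A^t) − (log Z_B^0 − log Z_A^0)| ≤` the discounted budget. [folklore] -/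
theorem abs_log_re_incr_sub_incr_le_local {wA wA₀ wB wB₀ : P → ℂ} {ω a d e m : P → ℝ} {L S : Finset P}
    (ha : ∀ γ, 0 ≤ a γ) (hd : ∀ γ, 0 ≤ d γ) (he : ∀ γ, 0 ≤ e γ)
    (hωA : ∀ δ ∈ L, ‖wA δ‖ ≤ ω δ) (hωA₀ : ∀ δ ∈ L, ‖wA₀ δ‖ ≤ ω δ) (hωB : ∀ δ ∈ L, ‖wB δ‖ ≤ ω δ) (hωB₀ : ∀ δ ∈ L, ‖wB₀ δ‖ ≤ ω δ)
    (hdom : ∀ γ ∈ L, ∑ γ' ∈ L with inc γ' γ, ω γ' * Real.exp (a γ' + (d γ' + e γ')) ≤ a γ)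
    (hAr : ∀ γ, (wA γ).im = 0) (hA₀r : ∀ γ, (wA₀ γ).im = 0) (hBr : ∀ γ, (wB γ).im = 0) (hB₀r : ∀ γ, (wB₀ γ).im = 0)
    (hSA : ∀ γ ∈ L, γ ∉ S → wA γ = wA₀ γ) (hSB : ∀ γ ∈ L, γ ∉ S → wB γ = wB₀ γ)
    (hm : ∀ C ⊆ L, (C ∩ S).Nonempty → IsPolymerCluster inc C → ∀ δ ∈ C, m δ ≤ ∑ γ ∈ C, e γ) :
    0 < (polymerPartitionFunction inc wA L).re ∧ 0 < (polymerPartitionFunction inc wA₀ L).re ∧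
    0 < (polymerPartitionFunction inc wB L).re ∧ 0 < (polymerPartitionFunction inc wB₀ L).re ∧
    |(Real.log (polymerPartitionFunction inc wB L).re - Real.log (polymerPartitionFunction inc wA L).re) -
        (Real.log (polymerPartitionFunction inc wB₀ L).re - Real.log (polymerPartitionFunction inc wA₀ L).re)| ≤
      ∑ δ ∈ L, Real.exp (-m δ) * ((‖wA δ - wB δ‖ + ‖wA₀ δ - wB₀ δ‖) * Real.exp (a δ + (d δ + e δ))) := by
  have hKA : IsKPVolume inc wA a L := isKPVolume_of_dominated hd he hωA hdom
  have hKA₀ : IsKPVolume inc wA₀ a L := isKPVolume_of_dominated hd he hωA₀ hdom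
  have hKB : IsKPVolume inc wB a L := isKPVolume_of_dominated hd he hωB hdom
  have hKB₀ : IsKPVolume inc wB₀ a L := isKPVolume_of_dominated hd he hωB₀ hdom
  have hZA := polymerLogZ_eq_log_of_real (inc := inc) hAr (B := L) fun t ht => polymerPartitionFunction_ne_zero_of_kp (hKA.ray ht) le_rfl
  have hZA₀ := polymerLogZ_eq_log_of_real (inc := inc) hA₀r (B := L) fun t ht =>
    polymerPartitionFunction_ne_zero_of_kp (hKA₀.ray ht) le_rfl
  have hZB := polymerLogZ_eq_log_of_real (inc := inc) hBr (B := L) fun t ht => polymerPartitionFunction_ne_zero_of_kp (hKB.ray ht) le_rfl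
  have hZB₀ := polymerLogZ_eq_log_of_real (inc := inc) hB₀r (B := L) fun t ht =>
    polymerPartitionFunction_ne_zero_of_kp (hKB₀.ray ht) le_rfl
  refine ⟨hZA.1, hZA₀.1, hZB.1, hZB₀.1, ?_⟩
  have h := norm_incr_sub_incr_le_local ha hd he hωA hωA₀ hωB hωB₀ hdom hSA hSB hm
  rw [hZA.2, hZA₀.2, hZB.2, hZB₀.2] at h
  simpa only [← Complex.ofReal_sub, Complex.norm_real, Real.norm_eq_abs] using h

end SourceLocal

/-! ## §3 ALONG `K`: a source-local reading of the dressed partition functions ⇒ `MatchingModConstants` with CANONICAL constants ⇒ `Target` -/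

section Target

variable [Std.Refl inc] [Std.Symm inc]

/-- **`MatchingModConstants` WITH CANONICAL CONSTANTS FROM A SOURCE-LOCAL READING** (the one-class ∕ pure small-field road to node U5's
target).  ONE sequence of dressed partition functions `Z : ℕ → ℝ → ℝ` is READ, on `|t| ≤ l₀`, as `Z K t = κA K · Z(L K; wA K t).re` (run A of
the pair `K`) and `Z (K+1) t = κB K · Z(L K; wB K t).re` (run B) — the dictionary E1∕E2 of `T4MatchingAssembly` with `t`-independent positive
normalisations `κA`, `κB` (explicit counterterms); all activities real, dominated by `ω K` obeying (1) with weight `d K + e K`; each run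
source-local off `S K`; discount `m K` on the clusters meeting `S K`; and the DISCOUNTED two-run budget at `(t, 0)` is `≤ vol · δ K`.  Then
`MatchingModConstants vol l₀ δ Z`, the constant at `K` being `(log κB K − log κA K) + (log Z(L K; wB K 0).re − log Z(L K; wA K 0).re)`.
(`0 ≤ l₀` puts the reference source `t = 0` in the window.) [folklore] -/
theorem matchingModConstants_of_sourceLocalReading {l₀ vol : ℝ} {δ : ℕ → ℝ} {Z : ℕ → ℝ → ℝ} (hl₀ : 0 ≤ l₀)
    (L S : ℕ → Finset P) (wA wB : ℕ → ℝ → P → ℂ) (ω a d e m : ℕ → P → ℝ) (κA κB : ℕ → ℝ)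
    (ha : ∀ K γ, 0 ≤ a K γ) (hd : ∀ K γ, 0 ≤ d K γ) (he : ∀ K γ, 0 ≤ e K γ)
    (hωA : ∀ K t, |t| ≤ l₀ → ∀ δ' ∈ L K, ‖wA K t δ'‖ ≤ ω K δ') (hωB : ∀ K t, |t| ≤ l₀ → ∀ δ' ∈ L K, ‖wB K t δ'‖ ≤ ω K δ')
    (hdom : ∀ K, ∀ γ ∈ L K, ∑ γ' ∈ L K with inc γ' γ, ω K γ' * Real.exp (a K γ' + (d K γ' + e K γ')) ≤ a K γ)
    (hAr : ∀ K t γ, (wA K t γ).im = 0) (hBr : ∀ K t γ, (wB K t γ).im = 0)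
    (hSA : ∀ K t, |t| ≤ l₀ → ∀ γ ∈ L K, γ ∉ S K → wA K t γ = wA K 0 γ)
    (hSB : ∀ K t, |t| ≤ l₀ → ∀ γ ∈ L K, γ ∉ S K → wB K t γ = wB K 0 γ)
    (hm : ∀ K, ∀ C ⊆ L K, (C ∩ S K).Nonempty → IsPolymerCluster inc C → ∀ δ' ∈ C, m K δ' ≤ ∑ γ ∈ C, e K γ)
    (hκA : ∀ K, 0 < κA K) (hκB : ∀ K, 0 < κB K)
    (hZA : ∀ K t, |t| ≤ l₀ → Z K t = κA K * (polymerPartitionFunction inc (wA K t) (L K)).re)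
    (hZB : ∀ K t, |t| ≤ l₀ → Z (K + 1) t = κB K * (polymerPartitionFunction inc (wB K t) (L K)).re)
    (hbud : ∀ K t, |t| ≤ l₀ →
      ∑ δ' ∈ L K, Real.exp (-m K δ') * ((‖wA K t δ' - wB K t δ'‖ + ‖wA K 0 δ' - wB K 0 δ'‖) *
        Real.exp (a K δ' + (d K δ' + e K δ'))) ≤ vol * δ K) :
    MatchingModConstants vol l₀ δ Z := by
  intro K
  have h0 : |(0 : ℝ)| ≤ l₀ := by simpa using hl₀
  refine ⟨(Real.log (κB K) - Real.log (κA K)) +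
    (Real.log (polymerPartitionFunction inc (wB K 0) (L K)).re - Real.log (polymerPartitionFunction inc (wA K 0) (L K)).re),
    fun t ht => ?_⟩
  obtain ⟨hpA, hpA₀, hpB, hpB₀, hincr⟩ := abs_log_re_incr_sub_incr_le_local (ha K) (hd K) (he K) (hωA K t ht) (hωA K 0 h0)
    (hωB K t ht) (hωB K 0 h0) (hdom K) (hAr K t) (hAr K 0) (hBr K t) (hBr K 0) (hSA K t ht) (hSB K t ht) (hm K)
  rw [hZB K t ht, hZA K t ht, Real.log_mul (hκB K).ne' hpB.ne', Real.log_mul (hκA K).ne' hpA.ne']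
  have hre : Real.log (κB K) + Real.log (polymerPartitionFunction inc (wB K t) (L K)).re -
      (Real.log (κA K) + Real.log (polymerPartitionFunction inc (wA K t) (L K)).re) -
      (Real.log (κB K) - Real.log (κA K) +
        (Real.log (polymerPartitionFunction inc (wB K 0) (L K)).re - Real.log (polymerPartitionFunction inc (wA K 0) (L K)).re)) =
      (Real.log (polymerPartitionFunction inc (wB K t) (L K)).re - Real.log (polymerPartitionFunction inc (wA K t) (L K)).re) -
        (Real.log (polymerPartitionFunction inc (wB K 0) (L K)).re - Real.log (polymerPartitionFunction inc (wA K 0) (L K)).re) := by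
    ring
  rw [hre]
  exact hincr.trans (hbud K t ht)

/-- **NODE U5's `Target` FROM A SOURCE-LOCAL READING**: `matchingModConstants_of_sourceLocalReading` with a summable budget sequence gives
`Spine.NE7.Target vol l₀ δ Z` — the node's DECL target in the one-class road, with canonical constants and a remainder that is LOCAL at the
source support.  Every hypothesis is a BINDER (produced by nobody for Bałaban's runs). [folklore] -/
theorem target_of_sourceLocalReading {l₀ vol : ℝ} {δ : ℕ → ℝ} {Z : ℕ → ℝ → ℝ} (hl₀ : 0 ≤ l₀)
    (L S : ℕ → Finset P) (wA wB : ℕ → ℝ → P → ℂ) (ω a d e m : ℕ → P → ℝ) (κA κB : ℕ → ℝ)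
    (ha : ∀ K γ, 0 ≤ a K γ) (hd : ∀ K γ, 0 ≤ d K γ) (he : ∀ K γ, 0 ≤ e K γ)
    (hωA : ∀ K t, |t| ≤ l₀ → ∀ δ' ∈ L K, ‖wA K t δ'‖ ≤ ω K δ') (hωB : ∀ K t, |t| ≤ l₀ → ∀ δ' ∈ L K, ‖wB K t δ'‖ ≤ ω K δ')
    (hdom : ∀ K, ∀ γ ∈ L K, ∑ γ' ∈ L K with inc γ' γ, ω K γ' * Real.exp (a K γ' + (d K γ' + e K γ')) ≤ a K γ)
    (hAr : ∀ K t γ, (wA K t γ).im = 0) (hBr : ∀ K t γ, (wB K t γ).im = 0)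
    (hSA : ∀ K t, |t| ≤ l₀ → ∀ γ ∈ L K, γ ∉ S K → wA K t γ = wA K 0 γ)
    (hSB : ∀ K t, |t| ≤ l₀ → ∀ γ ∈ L K, γ ∉ S K → wB K t γ = wB K 0 γ)
    (hm : ∀ K, ∀ C ⊆ L K, (C ∩ S K).Nonempty → IsPolymerCluster inc C → ∀ δ' ∈ C, m K δ' ≤ ∑ γ ∈ C, e K γ)
    (hκA : ∀ K, 0 < κA K) (hκB : ∀ K, 0 < κB K)
    (hZA : ∀ K t, |t| ≤ l₀ → Z K t = κA K * (polymerPartitionFunction inc (wA K t) (L K)).re)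
    (hZB : ∀ K t, |t| ≤ l₀ → Z (K + 1) t = κB K * (polymerPartitionFunction inc (wB K t) (L K)).re)
    (hbud : ∀ K t, |t| ≤ l₀ →
      ∑ δ' ∈ L K, Real.exp (-m K δ') * ((‖wA K t δ' - wB K t δ'‖ + ‖wA K 0 δ' - wB K 0 δ'‖) *
        Real.exp (a K δ' + (d K δ' + e K δ'))) ≤ vol * δ K)
    (hδ : Summable δ) : NE7.Target vol l₀ δ Z :=
  ⟨matchingModConstants_of_sourceLocalReading hl₀ L S wA wB ω a d e m κA κB ha hd he hωA hωB hdom hAr hBr hSA hSB hm hκA hκB hZA hZB hbud,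
    hδ⟩

end Target

/-! ## §4 Sanity: the displayed binders are jointly inhabited (content-free inhabitant) -/

section Sanity

/-- SANITY for §3 (A6 hygiene): the EMPTY polymer volume — no polymers, `Z ≡ 1`, normalisations `1`, zero activities, zero budget — inhabits
every hypothesis of `target_of_sourceLocalReading`, which then returns `Target 1 l₀ 0 1`.  Content-free; shows joint satisfiability only. [folklore] -/
theorem target_of_sourceLocalReading_empty {l₀ : ℝ} (hl₀ : 0 ≤ l₀) :
    NE7.Target 1 l₀ (fun _ => 0) (fun _ _ => (1 : ℝ)) := by
  -- the one-point polymer type with the total incompatibility (any reflexive symmetric relation would do)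
  haveI hrefl : Std.Refl (fun _ _ : Unit => True) := ⟨fun _ => trivial⟩
  haveI hsymm : Std.Symm (fun _ _ : Unit => True) := ⟨fun _ _ _ => trivial⟩
  refine target_of_sourceLocalReading (P := Unit) (inc := fun _ _ : Unit => True) hl₀ (fun _ => (∅ : Finset Unit))
    (fun _ => (∅ : Finset Unit))
    (fun _ _ _ => (0 : ℂ)) (fun _ _ _ => (0 : ℂ)) (fun _ _ => 0) (fun _ _ => 0) (fun _ _ => 0) (fun _ _ => 0) (fun _ _ => 0)
    (fun _ => 1) (fun _ => 1) (fun _ _ => le_rfl) (fun _ _ => le_rfl) (fun _ _ => le_rfl) ?_ ?_ ?_ ?_ ?_ ?_ ?_ ?_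
    (fun _ => one_pos) (fun _ => one_pos) ?_ ?_ ?_ (summable_zero)
  · intro K t _ δ' hδ'; simp at hδ'
  · intro K t _ δ' hδ'; simp at hδ'
  · intro K γ hγ; simp at hγ
  · intro K t γ; simp
  · intro K t γ; simp
  · intro K t _ γ hγ; simp at hγ
  · intro K t _ γ hγ; simp at hγ
  · intro K C hC hCS; simp [Finset.subset_empty.1 hC] at hCS
  · intro K t _; simp [polymerPartitionFunction, isCompatible_empty]
  · intro K t _; simp [polymerPartitionFunction, isCompatible_empty]
  · intro K t _; simp

end Sanity

end Summit.QuantumFields.YangMills.BalabanUVNodes.N19TargetOfSourceLocalGasReading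

end
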